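import Mathlib
import Summits.Ventures.DiscreteObjects.Mahler.SmythIsolation
import Summits.Ventures.DiscreteObjects.Mahler.MahlerMeasureAlgebraicInteger

/-!
# Smyth's theorem: the strict gap `M(P) > √((93+√2249)/80)` (venture `DiscreteObjects`, target L)

Cell `pub-namedobj`, seat `pub-namedobj-mahler` (gen 9). Framing: lottery ticket; floor = certified
bounds/negative ranges.

[McKee–Smyth, *Around the Unit Circle*, Thm 12.1] prints the isolation statement with a STRICT
inequality: "if `M(P(z)) > M(z³ - z - 1)` then `M(P(z)) > √((93 + √2249)/80) = 1.32487⋯`" — the equality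
`M(P) = √((93+√2249)/80)` being excluded because `M(P)` is an algebraic integer (Prop. 1.9,
`isIntegral_intMahlerMeasure_of_monic`) while `(93+√2249)/80`, a root of the primitive non-monic
`40u² - 93u + 40`, is not.  This file upgrades `intMahlerMeasure_eq_smythTheta_or_ge` accordingly.

* `not_isIntegral_smyth_gap_sq` — `(93+√2249)/80` is not an algebraic integer (its minimal polynomial over
  `ℚ` is `X² - (93/40)X + 1`, not in `ℤ[X]`);
* `intMahlerMeasure_ne_sqrt_smyth_gap` — `M(P) ≠ √((93+√2249)/80)` for monic `P ∈ ℤ[X]`;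
* `intMahlerMeasure_eq_smythTheta_or_gt` — **`M(P) = θ₀` or `M(P) > √((93+√2249)/80)`** (printed form);
* `smyth_isolation_published` — the same in the vocabulary of the Literature named fact
  `NonreciprocalMahlerBound` (`Polynomial.mahlerMeasure` over `ℂ`, hypothesis `M(z³-z-1) < M(P)`).
-/

namespace Summit.Ventures.DiscreteObjects.Mahler

open Polynomial

/-- `(93 + √2249)/80` is not an algebraic integer. -/
theorem not_isIntegral_smyth_gap_sq : ¬ IsIntegral ℤ ((93 + Real.sqrt 2249) / 80 : ℝ) := by
  intro hu
  set u : ℝ := (93 + Real.sqrt 2249) / 80 with hudef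
  have hs2 : Real.sqrt 2249 ^ 2 = 2249 := Real.sq_sqrt (by norm_num)
  -- the monic rational quadratic `p = X² - (93/40) X + 1` with `p(u) = 0`
  set p : ℚ[X] := X ^ 2 - C (93 / 40 : ℚ) * X + 1 with hp
  have hpdeg : p.natDegree = 2 := by rw [hp]; compute_degree!
  have hpm : p.Monic := by rw [hp]; monicity!
  have hu2 : u ^ 2 - 93 / 40 * u + 1 = 0 := by
    rw [hudef]; linear_combination (1 / 6400 : ℝ) * hs2
  have hpu : Polynomial.aeval u p = 0 := by
    rw [hp]
    simp only [map_add, map_sub, map_mul, map_pow, aeval_X, aeval_C, map_one, eq_ratCast]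
    push_cast
    linear_combination hu2
  have hirr : Irreducible p := by
    rw [hpm.irreducible_iff_roots_eq_zero_of_degree_le_three (by omega) (by omega)]
    apply Multiset.eq_zero_of_forall_notMem
    intro q hq
    rw [mem_roots hpm.ne_zero, IsRoot.def, hp] at hq
    simp only [eval_add, eval_sub, eval_mul, eval_pow, eval_X, eval_C, eval_one] at hq
    have hsq : IsSquare ((2249 : ℕ) : ℚ) := ⟨80 * q - 93, by push_cast; linear_combination (-6400 : ℚ) * hq⟩
    rw [Rat.isSquare_natCast_iff] at hsq
    obtain ⟨r, hr⟩ := hsq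
    rcases Nat.lt_or_ge r 48 with hr' | hr'
    · have : r * r ≤ 47 * 47 := Nat.mul_le_mul (by omega) (by omega)
      omega
    · have : 48 * 48 ≤ r * r := Nat.mul_le_mul hr' hr'
      omega
  -- the minimal polynomial of `u` over `ℚ`, computed in two ways
  have h1 : minpoly ℚ u = p := (minpoly.eq_of_irreducible_of_monic hirr hpu hpm).symm
  have h2 : minpoly ℚ u = (minpoly ℤ u).map (algebraMap ℤ ℚ) :=
    minpoly.isIntegrallyClosed_eq_field_fractions' ℚ hu
  have hcoeff := congrArg (fun r : ℚ[X] => r.coeff 1) (h1.symm.trans h2)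
  simp only [hp, coeff_add, coeff_sub, coeff_X_pow, coeff_C_mul, coeff_X_one, coeff_one, coeff_map,
    algebraMap_int_eq, eq_intCast] at hcoeff
  norm_num at hcoeff
  -- `hcoeff : -(93/40) = ((minpoly ℤ u).coeff 1 : ℚ)`
  have h3 : (40 : ℚ) * (((minpoly ℤ u).coeff 1 : ℤ) : ℚ) = -93 := by rw [← hcoeff]; norm_num
  have h4 : (40 : ℤ) * (minpoly ℤ u).coeff 1 = -93 := by exact_mod_cast h3
  omega

/-- **`M(P) ≠ √((93+√2249)/80)`** for a monic `P ∈ ℤ[X]` ([McKee–Smyth, Prop. 1.9]). -/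
theorem intMahlerMeasure_ne_sqrt_smyth_gap {P : ℤ[X]} (hmonic : P.Monic) :
    intMahlerMeasure P ≠ Real.sqrt ((93 + Real.sqrt 2249) / 80) := by
  intro h
  have hint := isIntegral_intMahlerMeasure_of_monic hmonic
  rw [h] at hint
  have h2 := hint.pow 2
  rw [Real.sq_sqrt (by positivity)] at h2
  exact not_isIntegral_smyth_gap_sq h2

/-- **Smyth's theorem, isolation of `θ₀`, printed form** ([McKee–Smyth, Thm 12.1, last part]).  For an
irreducible `P ∈ ℤ[X]` with `P(0) ≠ 0` which is neither reciprocal nor antireciprocal, either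
`M(P) = θ₀` or `M(P) > √((93+√2249)/80) = 1.32487…`. -/
theorem intMahlerMeasure_eq_smythTheta_or_gt {P : ℤ[X]} (hirr : Irreducible P) (h0 : P.coeff 0 ≠ 0)
    (h1 : P.reverse ≠ P) (h2 : P.reverse ≠ -P) :
    intMahlerMeasure P = smythTheta ∨ Real.sqrt ((93 + Real.sqrt 2249) / 80) < intMahlerMeasure P := by
  rcases intMahlerMeasure_eq_smythTheta_or_ge hirr h0 h1 h2 with h | h
  · exact Or.inl h
  · right
    refine lt_of_le_of_ne h (Ne.symm ?_)
    have hP0 : P ≠ 0 := fun h' => h0 (by simp [h'])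
    obtain ⟨-, hK2⟩ := sqrt_smyth_gap_const_bounds
    by_cases hlc : 2 ≤ |P.leadingCoeff|
    · have hle := abs_leadingCoeff_le_intMahlerMeasure P
      have : (2 : ℝ) ≤ |(P.leadingCoeff : ℝ)| := by exact_mod_cast hlc
      intro heq; linarith
    · have hlc1 : |P.leadingCoeff| = 1 := by
        have hne : P.leadingCoeff ≠ 0 := leadingCoeff_ne_zero.mpr hP0
        have := Int.one_le_abs hne
        omega
      rcases (abs_eq (zero_le_one' ℤ)).mp hlc1 with hl | hl
      · exact intMahlerMeasure_ne_sqrt_smyth_gap hl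
      · have hm : (-P).Monic := by rw [Monic, leadingCoeff_neg, hl, neg_neg]
        rw [← intMahlerMeasure_neg P]
        exact intMahlerMeasure_ne_sqrt_smyth_gap hm

/-- **The printed statement in the Literature vocabulary** (cf. `NonreciprocalMahlerBound`): for every
irreducible `P ∈ ℤ[z]` with `P(0) ≠ 0`, `P.reverse ≠ ±P`, if `M(P) > M(z³ - z - 1)` then
`M(P) > √((93 + √2249)/80)`. -/
theorem smyth_isolation_published :
    ∀ P : ℤ[X], Irreducible P → P.coeff 0 ≠ 0 → P.reverse ≠ P → P.reverse ≠ -P →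
      ((X ^ 3 - X - 1 : ℤ[X]).map (Int.castRingHom ℂ)).mahlerMeasure < (P.map (Int.castRingHom ℂ)).mahlerMeasure →
        Real.sqrt ((93 + Real.sqrt 2249) / 80) < (P.map (Int.castRingHom ℂ)).mahlerMeasure := by
  intro P hirr h0 h1 h2 hgt
  rw [mahlerMeasure_map_X_cube_sub_X_sub_one] at hgt
  rcases intMahlerMeasure_eq_smythTheta_or_gt hirr h0 h1 h2 with h | h
  · exact absurd h (ne_of_gt hgt)
  · exact h

end Summit.Ventures.DiscreteObjects.Mahler
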